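import Literature.NumberTheory.GaloisCohomology.Howard2004.RelaxedSelmerSelfAnnihilatorProofs
import HarnessLib

/-!
# Howard 2004, Lemma 1.5.6 «`A = A^⟂`» at an inert prime — FROBENIUS form (H²-detection as a binder,
# valid for NON-FREE level rings; proofs file)

Topic `NumberTheory/GaloisCohomology/Howard2004`. THEOREMS ONLY: no definition, no named fact, no instance, no
notation, no `sorry`. Cell `pub/bsd-print-x9`, print leaf G87 `thm161_dvrKolyvaginBound` (Howard Thm. 1.6.1); seat
`bsd-line-x9-p1-w4` g16, brick (READ-REBASE) part 2 = the TWIN of `RelaxedSelmerSelfAnnihilatorProofs` (same seat,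
brick (A-PERP)) with the dualizing-family binder removed.

WHY (x10b-p1-w6 g9 «READ-NONFREE», bsd-line-x10b-p1 LEAD g12 ruling 2026-08-29): `RelaxedSelmerSelfAnnihilatorProofs`
takes `hbij : Bijective fun x : R => fun i => exp (λ(r_i x))`, i.e. `(R, +) ≅ (ℤ/p^k)^ι`, false at the refined levels
`R/π^e` (`m ∤ e`) of a ramified DVR.  In its proofs `hbij` is used ONLY through the H²-detection «`H²(exp ∘ λ_{r_i}) z = 0 ∀ i
⟹ z = 0`» (`DualityDatumLocalCupAnnihilatorProofs.eq_zero_of_forall_cohomologyMap_expLam_lamMul_eq_zero`).  Here that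
detection is the Prop-binder

  `hdet : ∀ v (z : H²(K_v, R(1))), (∀ b : R, H²(exp ∘ λ_b) z = 0) → z = 0`,

true at every level (x10b-p1-w6's (READ-H2); at free levels from `hbij` by the lemma just cited), and the stability
binder `hstab` is quantified over all scalars `b ∈ R` instead of the family `r_i`.  Statements and proofs are otherwise
those of the original file (declaration names + `_frob`); §1 there (`τ^*` onto, `Θ_* τ^*` exhausts `H¹(K, T^∨(1))`,
`localTatePairing_toTateDual_pullback`) is hbij-free and imported, not restated:

* §2 **`localization_smul_mem_of_mem_dualLocalCondition_frob`** («`loc_v(Θ_* τ^* d) ∈ (𝓕_v)^*` ⇒ `loc_{σ v} d ∈ 𝓕_{σ v}`»);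
* §3 **`exists_mem_selmerGroup_localization_eq_of_forall_localCup_eq_zero_frob`** («`A^⟂ ⊆ A`», Howard Thm. 1.1.11 =
  `LocalInvariants.SelmerComplement` for the pair (strict at `q` ≤ relaxed at `q`));
* §4 **`localCup_localization_transportH1_eq_zero_frob`** («`A ⊆ A^⟂`» for `∪_e` itself),
  **`mem_map_localization_selmerGroup_iff_forall_localCup_eq_zero_frob`** and **`…_cast_eq_zero_frob`** («`A = A^⟂`», the
  hypothesis `hA` of `Algebra/Module/LagrangianSubmodulesDeltaTransfer.forall_pow_smul_eq_zero_of_lagrangian`).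

SOURCE. B. Howard, *The Heegner point Kolyvagin system*, Compositio Math. **140** (2004) = arXiv:1202.6340, Lemma 1.5.6
(arXiv Lemma 2.5.6, p. 10 L80–97) and Thm. 1.1.11 (arXiv 2.1.11, p. 6; Poitou–Tate for Selmer structures).
NOT HERE: `hdet` itself ((READ-H2)), the Frobenius character ((FROB-CHAR)), the family `inv` (named fact
`poitouTate_selmerStructure_duality`), `Θ` bijective, H.4 for `𝓕(n)`; `thm161_dvrKolyvaginBound` is NOT proved; no
summit statement is proved; the Birch–Swinnerton-Dyer conjecture is not proved by any of this.
References: [Howard2004HeegnerKolyvagin] Lemma 1.5.6, Thm. 1.1.11, §1.3 H.4, Def. 1.1.6/1.1.10; [MilneADT2006] I Thm. 4.10(b),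
I Cor. 2.3; [SerreGaloisCohomology1997] I §2.2–2.4, §5.1.
-/

set_option autoImplicit false

noncomputable section

open Function NumberField IsDedekindDomain Field CategoryTheory
open scoped NumberField

namespace Literature.NumberTheory.GaloisCohomology.Howard2004

open Literature.NumberTheory.GaloisRepresentations
open Literature.NumberTheory.GaloisRepresentations.DiscreteGaloisModule
open Literature.NumberTheory.EllipticCurves

variable {K : Type} [Field K] [NumberField K] {M : Type} [AddCommGroup M] [TopologicalSpace M]
  [DiscreteTopology M]

namespace DualityDatum

variable {R : Type} [CommRing R] [Module R M] [TopologicalSpace R] [DiscreteTopology R]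
  {p : ℕ} [Fact p.Prime] [Algebra ℤ_[p] R] {cd : ConjugationDatum K} {ρ : DiscreteGaloisModule K M}
  [Finite M] (D : DualityDatum p cd ρ R) {k : ℕ}
  (lam : R →+ ZMod (p ^ k))
  (hlam : ∀ (z : ℤ_[p]) (r : R), lam (algebraMap ℤ_[p] R z * r) = PadicInt.toZModPow k z * lam r)
  (exp : ZMod (p ^ k) →+ MuCarrier K (p ^ k))
  (hexp : ∀ (g : absoluteGaloisGroup K) (x : ZMod (p ^ k)),
    exp (cyclotomicCharacterModPow K p k g * x) = mu K (p ^ k) g (exp x))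

/-! ## §2 Reading the dual local condition `(𝓕_v)^*` on `T^∨(1)` back to `𝓕_{σ v}` on `T` -/

/-- **«`loc_v(Θ_* τ^* d) ∈ (𝓕_v)^*` ⇒ `loc_{σ v} d ∈ 𝓕_{σ v}`».**  At a finite place `v` let `𝓕` be
self-orthogonal under `D` (H.4: `𝓕_v` and the transport of `𝓕_{σ v}` are exact annihilators under `∪_e`),
`𝓕_v` stable under the scalars of `R`, the readings `H²(exp ∘ λ_b)`, `b ∈ R`, DETECTING `H²(K_v, R(1))` (`hdet`), and `inv_v` injective.  If the
localization at `v` of `Θ_*(τ^* d)` annihilates `𝓕_v` under the local Tate pairing read through `inv_v`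
(`LocalInvariants.dualLocalCondition`), then `loc_{σ v} d ∈ 𝓕_{σ v}`: the readings
`inv_v H²(exp∘λ)((b • a) ∪_e z)`, `b ∈ R`, of `z = transport_v(loc_{σv} d)` against `a ∈ 𝓕_v` all vanish, so
`a ∪_e z = 0` (`hdet`), so `z` lies in the transport of `𝓕_{σ v}` (H.4), and the transport is
injective. [cite: Howard2004HeegnerKolyvagin, §1.3 H.4 (arXiv p. 7 L78–82: «its own exact orthogonal complement») and Def. 1.1.6/1.1.10 (dual conditions)] [cite: MilneADT2006, Ch. I Cor. 2.3] -/
theorem localization_smul_mem_of_mem_dualLocalCondition_frob (hρ : ρ.IsScalarLinear R)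
    (inv : LocalInvariants K (p ^ k))
    (hdet : ∀ (v : Place K) (z : galoisCohomology (D.twistOne.toLocal v) 2),
      (∀ b : R, cohomologyMap (D.expLamLocalHom (lamMul lam b) (lamMul_semilinear lam hlam b) exp hexp v) 2 z = 0) →
        z = 0)
    (𝓕 : SelmerStructure ρ) (v : HeightOneSpectrum (𝓞 K)) (hinj : Injective (inv (Sum.inr v)))
    (horth : D.IsSelfOrthogonalAt 𝓕 v)
    (hstab : ∀ b : R, ∀ a ∈ 𝓕 (Sum.inr v), galoisCohomology.scalarMapH1 (ρ.toLocal (Sum.inr v))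
      (isScalarLinear_toLocal hρ (Sum.inr v)) b a ∈ 𝓕 (Sum.inr v))
    (d : galoisCohomology ρ 1)
    (hd : galoisCohomology.localization (ρ.tateDual (p ^ k)) (Sum.inr v) 1
        (galoisCohomology.map (D.toTateDual lam hlam exp hexp) 1 (galoisCohomology.pullback ρ cd.conj 1 d)) ∈
      inv.dualLocalCondition ρ (Sum.inr v) (𝓕 (Sum.inr v))) :
    galoisCohomology.localization ρ (Sum.inr (cd.σ • v)) 1 d ∈ 𝓕 (Sum.inr (cd.σ • v)) := by
  -- `z = transport_v (loc_{σ v} d)` annihilates `𝓕_v` under `∪_e` itself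
  have key : ∀ a ∈ 𝓕 (Sum.inr v), D.localCup (Sum.inr v) a
      (cd.transportH1 ρ v (galoisCohomology.localization ρ (Sum.inr (cd.σ • v)) 1 d)) = 0 := by
    intro a ha
    refine hdet (Sum.inr v) _ fun b => ?_
    rw [D.cohomologyMap_expLam_lamMul_localCup_left lam hlam exp hexp hρ (Sum.inr v) b]
    have h := (LocalInvariants.mem_dualLocalCondition_iff _ _ _ _ _).1 hd _ (hstab b a ha)
    rw [localTatePairingZMod_apply, D.localTatePairing_toTateDual_pullback lam hlam exp hexp] at h
    exact hinj (h.trans (map_zero _).symm)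
  -- H.4, second clause: `z` lies in the transport of `𝓕_{σ v}`; the transport is injective
  obtain ⟨w, hw, hwe⟩ := AddSubgroup.mem_map.1 (((horth).2 _).2 key)
  rw [← ConjugationDatum.transportH1_injective cd ρ v hwe]
  exact hw

/-! ## §3 «`A^⟂ ⊆ A`»: Howard Thm. 1.1.11 (`SelmerComplement`) for the pair (strict at `q`, relaxed at `q`) -/

/-- **Howard 2004, Lemma 1.5.6, `⊇` («`A^⟂ ⊆ A`») at an inert prime `q`, for the induced local pairing of H.4.**
Setting: `T` finite killed by `p^k`; `inv` a family of local invariant maps with Poitou–Tate duality for Selmer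
structures in Howard's form (`SelmerComplement`, Thm. 1.1.11) and `inv_v` injective at the finite places
(`IsPerfect`); `Θ = toTateDual λ exp` bijective and the readings `H²(exp ∘ λ_b)` detecting every `H²(K_v, R(1))` (`hdet`); `S` a
finite set of places containing `q` and the archimedean places and, outside `S`, `p ∤ v` and `T` unramified;
`𝓡` a Selmer structure unramified outside `S` with `𝓡_q = H¹(K_q, T)` (RELAXED at `q`) and `𝓡_v = 𝓕_v` at the
finite `v ≠ q`, where `𝓕` is self-orthogonal under `D` (H.4) and `R`-stable at every finite `v ≠ q`; all
classes of `T` localise to `0` at the infinite places (`K` imaginary quadratic in the source); `σ q = q`.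
CLAIM: if `x ∈ H¹(K_q, T)` satisfies `x ∪_e transport_q(loc_{σ q} d) = 0` for every `d ∈ H¹_𝓡(K, T)`, then
`x = loc_q c` for some `c ∈ H¹_𝓡(K, T)`.  («By global duality … `A = A^⟂`», `A = loc_q H¹_{𝓕^q(n)}(K, T)`.)
[cite: Howard2004HeegnerKolyvagin, Lemma 1.5.6 (arXiv:1202.6340 Lemma 2.5.6, p. 10 L80–97) and Thm. 1.1.11 (arXiv Thm. 2.1.11, p. 6)] [cite: MilneADT2006, Ch. I Thm. 4.10(b)] -/
theorem exists_mem_selmerGroup_localization_eq_of_forall_localCup_eq_zero_frob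
    (hn : ∀ m : M, (p ^ k) • m = 0) (hρ : ρ.IsScalarLinear R)
    (inv : LocalInvariants K (p ^ k)) (hSC : inv.SelmerComplement)
    (hinj : ∀ v : HeightOneSpectrum (𝓞 K), Injective (inv (Sum.inr v)))
    (hΘ : Bijective (D.toTateDual lam hlam exp hexp))
    (hdet : ∀ (v : Place K) (z : galoisCohomology (D.twistOne.toLocal v) 2),
      (∀ b : R, cohomologyMap (D.expLamLocalHom (lamMul lam b) (lamMul_semilinear lam hlam b) exp hexp v) 2 z = 0) →
        z = 0)
    (S : Finset (Place K))
    (hS : ∀ v : HeightOneSpectrum (𝓞 K), (Sum.inr v : Place K) ∉ S →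
      ((p ^ k : ℕ) : 𝓞 K) ∉ v.asIdeal ∧ GaloisRep.IsUnramifiedAt v ρ)
    (𝓕 𝓡 : SelmerStructure ρ) {q : HeightOneSpectrum (𝓞 K)} (hq : cd.σ • q = q)
    (hqS : (Sum.inr q : Place K) ∈ S) (h𝓡S : 𝓡.IsUnramifiedOutside S)
    (hrel : 𝓡 (Sum.inr q) = ⊤)
    (hoff : ∀ v : HeightOneSpectrum (𝓞 K), v ≠ q → 𝓡 (Sum.inr v) = 𝓕 (Sum.inr v))
    (horth : ∀ v : HeightOneSpectrum (𝓞 K), v ≠ q → D.IsSelfOrthogonalAt 𝓕 v)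
    (hstab : ∀ v : HeightOneSpectrum (𝓞 K), v ≠ q → ∀ b : R, ∀ a ∈ 𝓕 (Sum.inr v),
      galoisCohomology.scalarMapH1 (ρ.toLocal (Sum.inr v)) (isScalarLinear_toLocal hρ (Sum.inr v)) b a ∈
        𝓕 (Sum.inr v))
    (hinf : ∀ (w : InfinitePlace K) (c : galoisCohomology ρ 1),
      galoisCohomology.localization ρ (Sum.inl w) 1 c = 0)
    (x : galoisCohomology (ρ.toLocal (Sum.inr q)) 1)
    (hx : ∀ d ∈ 𝓡.selmerGroup, D.localCup (Sum.inr q) x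
      (cd.transportH1 ρ q (galoisCohomology.localization ρ (Sum.inr (cd.σ • q)) 1 d)) = 0) :
    ∃ c ∈ 𝓡.selmerGroup, galoisCohomology.localization ρ (Sum.inr q) 1 c = x := by
  classical
  -- the structure STRICT at `q`, equal to `𝓡` elsewhere
  obtain ⟨𝓢, h𝓢q, h𝓢v⟩ : ∃ 𝓢 : SelmerStructure ρ, 𝓢 (Sum.inr q) = ⊥ ∧
      ∀ v : Place K, v ≠ Sum.inr q → 𝓢 v = 𝓡 v :=
    ⟨Function.update 𝓡 (Sum.inr q) ⊥, Function.update_self _ _ _,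
      fun v hv => Function.update_of_ne hv _ _⟩
  have hle : 𝓢 ≤ 𝓡 := fun v => by
    by_cases hv : v = Sum.inr q
    · rw [hv, h𝓢q]; exact bot_le
    · rw [h𝓢v v hv]
  have h𝓢S : 𝓢.IsUnramifiedOutside S :=
    ⟨h𝓡S.1, fun v hv => by
      rw [h𝓢v (Sum.inr v) (fun h => hv (by rw [h]; exact hqS))]
      exact h𝓡S.2 v hv⟩
  -- the tuple `t = (x at q, 0 elsewhere)`
  obtain ⟨t, htq, htv⟩ : ∃ t : Π v : Place K, galoisCohomology (ρ.toLocal v) 1,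
      t (Sum.inr q) = x ∧ ∀ v : Place K, v ≠ Sum.inr q → t v = 0 :=
    ⟨Function.update (fun _ => 0) (Sum.inr q) x, Function.update_self _ _ _,
      fun v hv => Function.update_of_ne hv _ _⟩
  have ht𝓡 : ∀ v ∈ S, t v ∈ 𝓡 v := by
    intro v _
    by_cases hv : v = Sum.inr q
    · subst hv; rw [htq, hrel]; trivial
    · rw [htv v hv]; exact zero_mem _
  -- the pairing hypothesis of Thm. 1.1.11 (i): only the term at `q` survives, and it vanishes by `hx`
  have hpair : ∀ y ∈ (inv.dualSelmerStructure ρ 𝓢).selmerGroup,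
      ∑ v ∈ S, localTatePairingZMod ρ (p ^ k) v (inv v) (t v)
        (galoisCohomology.localization (ρ.tateDual (p ^ k)) v 1 y) = 0 := by
    intro y hy
    rw [Finset.sum_eq_single_of_mem (Sum.inr q : Place K) hqS
      (fun v _ hv => by rw [htv v hv, map_zero, AddMonoidHom.zero_apply]), htq]
    obtain ⟨d, rfl⟩ := D.exists_eq_map_toTateDual_pullback lam hlam exp hexp hΘ y
    -- the local conditions of `y = Θ_*(τ^* d)` off `q` say `d ∈ H¹_𝓡(K, T)`
    have hd : d ∈ 𝓡.selmerGroup := by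
      rw [SelmerStructure.mem_selmerGroup_iff]
      rintro (w | u)
      · rw [hinf w d]; exact zero_mem _
      · by_cases hu : u = q
        · rw [hu, hrel]; trivial
        · have hv : cd.σ • u ≠ q := cd.smul_ne_of_ne hq hu
          have hyv := (SelmerStructure.mem_selmerGroup_iff _ _).1 hy (Sum.inr (cd.σ • u))
          rw [LocalInvariants.dualSelmerStructure_apply,
            h𝓢v (Sum.inr (cd.σ • u)) (fun h => hv (Sum.inr_injective h)), hoff _ hv] at hyv
          have hmem := D.localization_smul_mem_of_mem_dualLocalCondition_frob lam hlam exp hexp hρ inv hdet 𝓕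
            (cd.σ • u) (hinj _) (horth _ hv) (hstab _ hv) d hyv
          rw [cd.smul_smul_place] at hmem
          rw [hoff u hu]
          exact hmem
    rw [localTatePairingZMod_apply, D.localTatePairing_toTateDual_pullback lam hlam exp hexp, hx d hd]
    exact (congrArg (inv (Sum.inr q)) (map_zero _)).trans (map_zero _)
  -- Poitou–Tate: `t` is a localization modulo `𝓢`
  obtain ⟨c, hc, hcS⟩ := (hSC ρ hn S hS 𝓢 𝓡 hle h𝓢S h𝓡S).1 t ht𝓡 hpair
  refine ⟨c, hc, ?_⟩
  have h := hcS (Sum.inr q) hqS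
  rw [h𝓢q, htq, AddSubgroup.mem_bot, sub_eq_zero] at h
  exact h

/-! ## §4 «`A ⊆ A^⟂`» for `∪_e` itself, and «`A = A^⟂`» as one statement -/

include hlam hexp in
/-- **«`A ⊆ A^⟂`» for the `R(1)`-valued pairing itself**: for `c, d` satisfying the self-orthogonal,
`R`-stable conditions `𝓕_v` at every finite `v ≠ q` (classes of the structure RELAXED at the inert `q`)
and localising to `0` at the infinite places, `loc_q c ∪_e transport_q(loc_{σ q} d) = 0` in `H²(K_q, R(1))`
— the readings `inv_q H²(exp ∘ λ_b)(·) = inv_q H²(exp ∘ λ)(loc_q (b • c) ∪_e ·)`, `b ∈ R`, all vanish by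
reciprocity (`inv_cohomologyMap_localCup_transportH1_eq_zero`), and they detect `H²(K_q, R(1))` (`hdet`). [cite: Howard2004HeegnerKolyvagin, Lemma 1.5.6 (arXiv p. 10 L86–93: «which shows that `A ⊂ A^⟂`»)] [cite: MilneADT2006, Ch. I Thm. 4.10 (reciprocity) and Cor. 2.3] -/
theorem localCup_localization_transportH1_eq_zero_frob (hn : ∀ m : M, (p ^ k) • m = 0)
    (hρ : ρ.IsScalarLinear R) (inv : LocalInvariants K (p ^ k)) (hPT : inv.SumLocalTermEqZero)
    (hdet : ∀ (v : Place K) (z : galoisCohomology (D.twistOne.toLocal v) 2),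
      (∀ b : R, cohomologyMap (D.expLamLocalHom (lamMul lam b) (lamMul_semilinear lam hlam b) exp hexp v) 2 z = 0) →
        z = 0)
    (𝓕 : SelmerStructure ρ) {q : HeightOneSpectrum (𝓞 K)} (hq : cd.σ • q = q)
    (hinj : Injective (inv (Sum.inr q : Place K)))
    (horth : ∀ v : HeightOneSpectrum (𝓞 K), v ≠ q → D.IsSelfOrthogonalAt 𝓕 v)
    (hstab : ∀ v : HeightOneSpectrum (𝓞 K), v ≠ q → ∀ b : R, ∀ a ∈ 𝓕 (Sum.inr v),
      galoisCohomology.scalarMapH1 (ρ.toLocal (Sum.inr v)) (isScalarLinear_toLocal hρ (Sum.inr v)) b a ∈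
        𝓕 (Sum.inr v))
    {c d : galoisCohomology ρ 1}
    (hc : ∀ v : HeightOneSpectrum (𝓞 K), v ≠ q →
      galoisCohomology.localization ρ (Sum.inr v) 1 c ∈ 𝓕 (Sum.inr v))
    (hd : ∀ v : HeightOneSpectrum (𝓞 K), v ≠ q →
      galoisCohomology.localization ρ (Sum.inr v) 1 d ∈ 𝓕 (Sum.inr v))
    (hinf : ∀ (w : InfinitePlace K) (c : galoisCohomology ρ 1),
      galoisCohomology.localization ρ (Sum.inl w) 1 c = 0) :
    D.localCup (Sum.inr q) (galoisCohomology.localization ρ (Sum.inr q) 1 c)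
      (cd.transportH1 ρ q (galoisCohomology.localization ρ (Sum.inr (cd.σ • q)) 1 d)) = 0 := by
  refine hdet (Sum.inr q) _ fun b => ?_
  rw [D.cohomologyMap_expLam_lamMul_localCup_left lam hlam exp hexp hρ (Sum.inr q) b,
    ← galoisCohomology.localization_scalarMapH1 hρ (Sum.inr q) b c]
  refine D.cohomologyMap_localCup_transportH1_eq_zero lam hlam exp hexp hn inv hPT 𝓕 hq hinj horth
    (fun v hv => ?_) hd (fun w => hinf w _)
  rw [galoisCohomology.localization_scalarMapH1 hρ (Sum.inr v) b c]
  exact hstab v hv b _ (hc v hv)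

/-- **Howard 2004, Lemma 1.5.6 at an inert prime: «`A = A^⟂`» for `A = loc_q H¹_𝓡(K, T)`** under the induced
local pairing `(x, a) ↦ x ∪_e transport_q a` of H.4 — both inclusions as one equivalence, in the hypotheses of
`exists_mem_selmerGroup_localization_eq_of_forall_localCup_eq_zero_frob` plus reciprocity (`SumLocalTermEqZero`):
`x ∈ loc_q(H¹_𝓡(K, T)) ↔ ∀ d ∈ H¹_𝓡(K, T), x ∪_e transport_q(loc_{σ q} d) = 0`.  This is the hypothesis
«`A` maximal isotropic» of Lemma 1.5.7 / Prop. 1.5.9 for `𝓡 = 𝓕^q(n)`.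
[cite: Howard2004HeegnerKolyvagin, Lemma 1.5.6 (arXiv:1202.6340 Lemma 2.5.6, p. 10 L80–97) and Lemma 1.5.7 (p. 10 L112–113: «`A` is maximal isotropic by the previous lemma»)] [cite: MilneADT2006, Ch. I Thm. 4.10(b)] -/
theorem mem_map_localization_selmerGroup_iff_forall_localCup_eq_zero_frob
    (hn : ∀ m : M, (p ^ k) • m = 0) (hρ : ρ.IsScalarLinear R)
    (inv : LocalInvariants K (p ^ k)) (hPT : inv.SumLocalTermEqZero) (hSC : inv.SelmerComplement)
    (hinj : ∀ v : HeightOneSpectrum (𝓞 K), Injective (inv (Sum.inr v)))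
    (hΘ : Bijective (D.toTateDual lam hlam exp hexp))
    (hdet : ∀ (v : Place K) (z : galoisCohomology (D.twistOne.toLocal v) 2),
      (∀ b : R, cohomologyMap (D.expLamLocalHom (lamMul lam b) (lamMul_semilinear lam hlam b) exp hexp v) 2 z = 0) →
        z = 0)
    (S : Finset (Place K))
    (hS : ∀ v : HeightOneSpectrum (𝓞 K), (Sum.inr v : Place K) ∉ S →
      ((p ^ k : ℕ) : 𝓞 K) ∉ v.asIdeal ∧ GaloisRep.IsUnramifiedAt v ρ)
    (𝓕 𝓡 : SelmerStructure ρ) {q : HeightOneSpectrum (𝓞 K)} (hq : cd.σ • q = q)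
    (hqS : (Sum.inr q : Place K) ∈ S) (h𝓡S : 𝓡.IsUnramifiedOutside S)
    (hrel : 𝓡 (Sum.inr q) = ⊤)
    (hoff : ∀ v : HeightOneSpectrum (𝓞 K), v ≠ q → 𝓡 (Sum.inr v) = 𝓕 (Sum.inr v))
    (horth : ∀ v : HeightOneSpectrum (𝓞 K), v ≠ q → D.IsSelfOrthogonalAt 𝓕 v)
    (hstab : ∀ v : HeightOneSpectrum (𝓞 K), v ≠ q → ∀ b : R, ∀ a ∈ 𝓕 (Sum.inr v),
      galoisCohomology.scalarMapH1 (ρ.toLocal (Sum.inr v)) (isScalarLinear_toLocal hρ (Sum.inr v)) b a ∈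
        𝓕 (Sum.inr v))
    (hinf : ∀ (w : InfinitePlace K) (c : galoisCohomology ρ 1),
      galoisCohomology.localization ρ (Sum.inl w) 1 c = 0)
    (x : galoisCohomology (ρ.toLocal (Sum.inr q)) 1) :
    x ∈ 𝓡.selmerGroup.map (galoisCohomology.localization ρ (Sum.inr q) 1) ↔
      ∀ d ∈ 𝓡.selmerGroup, D.localCup (Sum.inr q) x
        (cd.transportH1 ρ q (galoisCohomology.localization ρ (Sum.inr (cd.σ • q)) 1 d)) = 0 := by
  constructor
  · intro hx d hd
    obtain ⟨c, hc, rfl⟩ := AddSubgroup.mem_map.1 hx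
    rw [SelmerStructure.mem_selmerGroup_iff] at hc hd
    exact D.localCup_localization_transportH1_eq_zero_frob lam hlam exp hexp hn hρ inv hPT hdet 𝓕 hq (hinj q)
      horth hstab (fun v hv => hoff v hv ▸ hc (Sum.inr v)) (fun v hv => hoff v hv ▸ hd (Sum.inr v)) hinf
  · intro hx
    exact D.exists_mem_selmerGroup_localization_eq_of_forall_localCup_eq_zero_frob lam hlam exp
      hexp hn hρ inv hSC hinj hΘ hdet S hS 𝓕 𝓡 hq hqS h𝓡S hrel hoff horth hstab hinf x hx

/-- **«`A = A^⟂`», local form**: with `A = loc_q(H¹_𝓡(K, T)) ≤ H¹(K_q, T)` and the pairing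
`(x, a) ↦ x ∪_e transport_q(a)` on `H¹(K_q, T)` (the class `a` cast to `H¹(K_{σ q}, T)` along the place
datum `σ q = q`, `InertLocalTauProofs.cast_localization`): `x ∈ A ↔ ∀ a ∈ A, x ∪_e transport_q(a) = 0` —
the shape `∀ x, x ∈ A ↔ ∀ a ∈ A, B x a = 0` of the hypothesis `hA` of the Lagrangian algebra
(`LagrangianSubmodulesDeltaTransfer.forall_pow_smul_eq_zero_of_lagrangian`).
[cite: Howard2004HeegnerKolyvagin, Lemma 1.5.6 (arXiv:1202.6340 Lemma 2.5.6, p. 10 L80–97) and Lemma 1.5.7 (p. 10 L112–113)] [cite: MilneADT2006, Ch. I Thm. 4.10(b)] -/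
theorem mem_map_localization_selmerGroup_iff_forall_localCup_cast_eq_zero_frob
    (hn : ∀ m : M, (p ^ k) • m = 0) (hρ : ρ.IsScalarLinear R)
    (inv : LocalInvariants K (p ^ k)) (hPT : inv.SumLocalTermEqZero) (hSC : inv.SelmerComplement)
    (hinj : ∀ v : HeightOneSpectrum (𝓞 K), Injective (inv (Sum.inr v)))
    (hΘ : Bijective (D.toTateDual lam hlam exp hexp))
    (hdet : ∀ (v : Place K) (z : galoisCohomology (D.twistOne.toLocal v) 2),
      (∀ b : R, cohomologyMap (D.expLamLocalHom (lamMul lam b) (lamMul_semilinear lam hlam b) exp hexp v) 2 z = 0) →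
        z = 0)
    (S : Finset (Place K))
    (hS : ∀ v : HeightOneSpectrum (𝓞 K), (Sum.inr v : Place K) ∉ S →
      ((p ^ k : ℕ) : 𝓞 K) ∉ v.asIdeal ∧ GaloisRep.IsUnramifiedAt v ρ)
    (𝓕 𝓡 : SelmerStructure ρ) {q : HeightOneSpectrum (𝓞 K)} (hq : cd.σ • q = q)
    (hqS : (Sum.inr q : Place K) ∈ S) (h𝓡S : 𝓡.IsUnramifiedOutside S)
    (hrel : 𝓡 (Sum.inr q) = ⊤)
    (hoff : ∀ v : HeightOneSpectrum (𝓞 K), v ≠ q → 𝓡 (Sum.inr v) = 𝓕 (Sum.inr v))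
    (horth : ∀ v : HeightOneSpectrum (𝓞 K), v ≠ q → D.IsSelfOrthogonalAt 𝓕 v)
    (hstab : ∀ v : HeightOneSpectrum (𝓞 K), v ≠ q → ∀ b : R, ∀ a ∈ 𝓕 (Sum.inr v),
      galoisCohomology.scalarMapH1 (ρ.toLocal (Sum.inr v)) (isScalarLinear_toLocal hρ (Sum.inr v)) b a ∈
        𝓕 (Sum.inr v))
    (hinf : ∀ (w : InfinitePlace K) (c : galoisCohomology ρ 1),
      galoisCohomology.localization ρ (Sum.inl w) 1 c = 0)
    (x : galoisCohomology (ρ.toLocal (Sum.inr q)) 1) :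
    x ∈ 𝓡.selmerGroup.map (galoisCohomology.localization ρ (Sum.inr q) 1) ↔
      ∀ a ∈ 𝓡.selmerGroup.map (galoisCohomology.localization ρ (Sum.inr q) 1),
        D.localCup (Sum.inr q) x (cd.transportH1 ρ q
          (hq.symm ▸ a : galoisCohomology (ρ.toLocal (Sum.inr (cd.σ • q))) 1)) = 0 := by
  rw [D.mem_map_localization_selmerGroup_iff_forall_localCup_eq_zero_frob lam hlam exp hexp hn hρ inv hPT hSC hinj
    hΘ hdet S hS 𝓕 𝓡 hq hqS h𝓡S hrel hoff horth hstab hinf x]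
  constructor
  · rintro h a ⟨d, hd, rfl⟩
    rw [cast_localization ρ hq.symm d]
    exact h d hd
  · intro h d hd
    rw [← cast_localization ρ hq.symm d]
    exact h _ ⟨d, hd, rfl⟩

end DualityDatum

end Literature.NumberTheory.GaloisCohomology.Howard2004

end
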